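import Literature.AnabelianGeometry.SemiGraphs.ArithThm54CapstoneCorollaryTopology
import HarnessLib

/-!
# [SemiAnbd] Thm 5.4 (i) ∧ (ii) at `π₁^temp(𝒢) ⋊^out Π_A` — the binder `hA : IsTempered Π_A` DISCHARGED for a
# PROFINITE arithmetic component (Def 5.1 (i): `Π_A = π̂₁(A)`; Rmk 3.1.1), T54-B sub-row «T54·hA» (proof-only)

Mochizuki, *Semi-graphs of anabelioids*, Publ. RIMS **42** (2006), §5 Def 5.1 (i) p. 62 ("Let `A` be a slim
connected anabelioid, equipped with a basepoint, so we may speak of `π̂₁(A)` … an action of `π̂₁(A)` on `𝒢`"),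
Thm 5.4 (i)(ii) p. 66, and §3 Rmk 3.1.1 p. 33 ("every profinite group is tempered")
[cite: MochizukiSemiAnbd2006, Thm 5.4 (i), p. 66].

PROOF-ONLY junction (abc-iut cell, L3, producer row T54-B = GAP-LEDGER G-w4d053-1, sub-row «T54·hA», L3-lead
α78; seat abc-iut-w6-d085).  abc-iut-w6-d070's `arithMaximalCompactStatement_outerAction_piPresentation_levelTopology`
(ArithThm54CapstoneCorollaryTopology.lean, p435643) carries, first in its residual list
«hA · hV hE hopen hBR · hP · hLst · hK1′ · noSwitchBase · stabBranchPairAug · hest · hbot», the binder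
`hA : IsTempered Π_A` — the arithmetic group must be tempered for abc-iut-w6-d070's level-B topology
`arithLevelTopology` (p431501).  In print the arithmetic component is the slim connected anabelioid `A` and
`Π_A := π̂₁(A)` is PROFINITE (Def 5.1 (i)), so `hA` is [SemiAnbd] Rmk 3.1.1, a THEOREM of the tree
(`IsTempered.of_profinite`, TemperedGroups.lean, abc-iut-L3-t2).  The corollary already takes
`[CompactSpace Π_A]`; here the remaining print-faithful instance binder `[TotallyDisconnectedSpace Π_A]` is added
and `hA` is supplied BY NAME — nothing else changes (the topology pin `hinst` now reads
`canonicalArithLevelTopology h37 IsTempered.of_profinite …`).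

* `arithMaximalCompactStatement_outerAction_piPresentation_profinite` — Thm 5.4 (i) ∧ (ii) at the outer model
  over a profinite `Π_A`; RESIDUAL binders = «hV hE hopen hBR · hP · hLst · hK1′ · noSwitchBase · stabBranchPairAug ·
  hest · hbot» (design data `T R Rc w₀`, `h37`, `hG`, finiteness and the profinite instances of `Π_A` aside).

Nothing beyond composition is proved; typed ≠ proved for the residual inputs; no side taken on [IUTchIII] Cor 3.12.
-/

namespace Literature.AnabelianGeometry.SemiGraphs

namespace ProfiniteSemiGraph

open CategoryTheory Topology Filter
open Literature.AnabelianGeometry.EtaleTheta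
open scoped Pointwise

universe u

variable {𝒢 : ProfiniteSemiGraph.{u}}

/-- **[SemiAnbd] Thm 5.4 (i) ∧ (ii) at `π₁^temp(𝒢) ⋊^out Π_A` for a PROFINITE arithmetic group `Π_A = π̂₁(A)`**
(Def 5.1 (i)): abc-iut-w6-d070's `arithMaximalCompactStatement_outerAction_piPresentation_levelTopology` with its
first residual binder `hA : IsTempered Π_A` DISCHARGED by Rmk 3.1.1 (`IsTempered.of_profinite`) under the
print-faithful instances `[CompactSpace Π_A] [TotallyDisconnectedSpace Π_A]`; the topology of `E` is pinned to
`canonicalArithLevelTopology h37 IsTempered.of_profinite …`.  Residual binders: `hV hE hopen hBR` (design data),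
`hP`, `hLst`, `hK1'`, `noSwitchBase`, `stabBranchPairAug`, `hest`, `hbot`.
[cite: MochizukiSemiAnbd2006, Thm 5.4 (i), p. 66] -/
theorem arithMaximalCompactStatement_outerAction_piPresentation_profinite
    (h37 : 𝒢.Thm37Hypotheses) (hG : 𝒢.graph.IsGraph) [Finite 𝒢.graph.Vertex] [Finite 𝒢.graph.Branch]
    {PA : Type u} [Group PA] [TopologicalSpace PA] [IsTopologicalGroup PA] [CompactSpace PA]
    [TotallyDisconnectedSpace PA]
    (ρ' : PA →* TopOut (𝒢.temperedPiChart h37.toProp36Hypotheses).G) (baseAct : PA →* Aut 𝒢.graph)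
    [inst : TopologicalSpace (outerSemidirectProduct ρ')]
    (T : ∀ w : 𝒢.graph.Vertex, (𝒢.galoisLevelData h37.toProp36Hypotheses).PointSeq h37.toProp36Hypotheses.isCountable w) (R : SemiGraph.RefBranches 𝒢.graph)
    (Rc : ChartRepresentatives (𝒢.temperedPiChart h37.toProp36Hypotheses))
    (hV : ∀ (a : PA) (v : 𝒢.graph.Vertex) (H : Subgroup (𝒢.temperedPiChart h37.toProp36Hypotheses).G), H ∈ verticialSubgroups (𝒢.temperedPiChart h37.toProp36Hypotheses) v →
      ∃ φ : contMulAut (𝒢.temperedPiChart h37.toProp36Hypotheses).G, TopOut.mk (𝒢.temperedPiChart h37.toProp36Hypotheses).G φ = ρ' a ∧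
        H.map (φ : MulAut (𝒢.temperedPiChart h37.toProp36Hypotheses).G).toMonoidHom ∈ verticialSubgroups (𝒢.temperedPiChart h37.toProp36Hypotheses) ((baseAct a).hom.vertexMap v))
    (hE : ∀ (a : PA) (e : 𝒢.graph.Edge) (K : Subgroup (𝒢.temperedPiChart h37.toProp36Hypotheses).G), K ∈ edgeLikeSubgroups (𝒢.temperedPiChart h37.toProp36Hypotheses) e →
      ∃ φ : contMulAut (𝒢.temperedPiChart h37.toProp36Hypotheses).G, TopOut.mk (𝒢.temperedPiChart h37.toProp36Hypotheses).G φ = ρ' a ∧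
        K.map (φ : MulAut (𝒢.temperedPiChart h37.toProp36Hypotheses).G).toMonoidHom ∈ edgeLikeSubgroups (𝒢.temperedPiChart h37.toProp36Hypotheses) ((baseAct a).hom.edgeMap e))
    (hopen : ∃ U : Subgroup PA, IsOpen (U : Set PA) ∧ ∀ a ∈ U,
      (∀ v, (baseAct a).hom.vertexMap v = v) ∧ (∀ e, (baseAct a).hom.edgeMap e = e) ∧
        ∀ b, (baseAct a).hom.branchMap b = b)
    (hBR : ∀ (a : PA) (b : 𝒢.graph.Branch) (v : 𝒢.graph.Vertex) (hb : 𝒢.graph.abuts b = some v)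
      (φ : 𝒢.Gv v →ₜ* (𝒢.temperedPiChart h37.toProp36Hypotheses).G), IsVerticialHom (𝒢.temperedPiChart h37.toProp36Hypotheses) v φ →
      ∃ Φ : contMulAut (𝒢.temperedPiChart h37.toProp36Hypotheses).G, TopOut.mk (𝒢.temperedPiChart h37.toProp36Hypotheses).G Φ = ρ' a ∧
        ∃ φ' : 𝒢.Gv ((baseAct a).hom.vertexMap v) →ₜ* (𝒢.temperedPiChart h37.toProp36Hypotheses).G,
          IsVerticialHom (𝒢.temperedPiChart h37.toProp36Hypotheses) ((baseAct a).hom.vertexMap v) φ' ∧ ∃ x' : (𝒢.temperedPiChart h37.toProp36Hypotheses).G,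
            Subgroup.map (Φ : MulAut (𝒢.temperedPiChart h37.toProp36Hypotheses).G).toMonoidHom φ.toMonoidHom.range =
              Subgroup.map (MulAut.conj x').toMonoidHom φ'.toMonoidHom.range ∧
            Subgroup.map (Φ : MulAut (𝒢.temperedPiChart h37.toProp36Hypotheses).G).toMonoidHom
                (Subgroup.map φ.toMonoidHom (𝒢.branchSubgroup b v hb)) =
              Subgroup.map (MulAut.conj x').toMonoidHom
                (Subgroup.map φ'.toMonoidHom
                  (𝒢.branchSubgroup ((baseAct a).hom.branchMap b) ((baseAct a).hom.vertexMap v)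
                    ((baseAct a).hom.abuts_branchMap b v hb))))
    (hP : ((𝒢.galoisLevelData h37.toProp36Hypotheses).piPresentation h37.toProp36Hypotheses.isCountable T R).IsArithCompatible (((contMulAut (𝒢.temperedPiChart h37.toProp36Hypotheses).G).subtype.comp (MonoidHom.fst (contMulAut (𝒢.temperedPiChart h37.toProp36Hypotheses).G) PA)).comp (outerSemidirectProduct ρ').subtype) (baseAct.comp (outerSemidirectProductSnd ρ')))
    (w₀ : 𝒢.graph.Vertex)
    (hLst : ∀ (n : ℕ) (e : outerSemidirectProduct ρ') (x : (𝒢.temperedPiChart h37.toProp36Hypotheses).G), x ∈ ((𝒢.galoisLevelData h37.toProp36Hypotheses).piLevelAut h37.toProp36Hypotheses.isCountable (𝒢.galoisLevelData_hconn h37.toProp36Hypotheses) n).ker → (((contMulAut (𝒢.temperedPiChart h37.toProp36Hypotheses).G).subtype.comp (MonoidHom.fst (contMulAut (𝒢.temperedPiChart h37.toProp36Hypotheses).G) PA)).comp (outerSemidirectProduct ρ').subtype) e x ∈ ((𝒢.galoisLevelData h37.toProp36Hypotheses).piLevelAut h37.toProp36Hypotheses.isCountable (𝒢.galoisLevelData_hconn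 h37.toProp36Hypotheses) n).ker)
    (hK1' : ∀ n, IsOpen (((((𝒢.galoisLevelData h37.toProp36Hypotheses).piPresentation h37.toProp36Hypotheses.isCountable T R).levelKer hP
        ((𝒢.galoisLevelData h37.toProp36Hypotheses).projAut h37.toProp36Hypotheses.isCountable n).ker
        ((𝒢.galoisLevelData h37.toProp36Hypotheses).hKst_of_hLst_outerAction h37.toProp36Hypotheses.isCountable (𝒢.galoisLevelData_hconn h37.toProp36Hypotheses) T R ρ' hP hLst n)).map (outerSemidirectProductSnd ρ') :
      Subgroup PA) : Set PA))
    -- the topology of `E` IS the canonical level topology, at `hA := IsTempered.of_profinite`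
    (hinst : inst = canonicalArithLevelTopology h37 IsTempered.of_profinite ρ' baseAct T R hP w₀ hLst hK1')
    (noSwitchBase : NoBranchSwitching 𝒢.graph.edgeOf
      (fun (a : PA) (b : 𝒢.graph.Branch) => (baseAct a).hom.branchMap b))
    (stabBranchPairAug : ∀ (C : Subgroup (outerSemidirectProduct ρ')),
      IsCompact (C : Set (outerSemidirectProduct ρ')) →
      ∀ (j₀ : ℕ) (w : ∀ i : {i : ℕ // j₀ ≤ i}, (((𝒢.galoisLevelData h37.toProp36Hypotheses).piPresentation h37.toProp36Hypotheses.isCountable T R).cosetGraph ((𝒢.galoisLevelData h37.toProp36Hypotheses).piLevelAut h37.toProp36Hypotheses.isCountable (𝒢.galoisLevelData_hconn h37.toProp36Hypotheses) i.1).ker).Vertex)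
      (β β' : ∀ i : {i : ℕ // j₀ ≤ i}, (((𝒢.galoisLevelData h37.toProp36Hypotheses).piPresentation h37.toProp36Hypotheses.isCountable T R).cosetGraph ((𝒢.galoisLevelData h37.toProp36Hypotheses).piLevelAut h37.toProp36Hypotheses.isCountable (𝒢.galoisLevelData_hconn h37.toProp36Hypotheses) i.1).ker).Branch),
      (∀ i, β i ≠ β' i ∧ (((𝒢.galoisLevelData h37.toProp36Hypotheses).piPresentation h37.toProp36Hypotheses.isCountable T R).cosetGraph ((𝒢.galoisLevelData h37.toProp36Hypotheses).piLevelAut h37.toProp36Hypotheses.isCountable (𝒢.galoisLevelData_hconn h37.toProp36Hypotheses) i.1).ker).abuts (β i) = some (w i) ∧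
        (((𝒢.galoisLevelData h37.toProp36Hypotheses).piPresentation h37.toProp36Hypotheses.isCountable T R).cosetGraph ((𝒢.galoisLevelData h37.toProp36Hypotheses).piLevelAut h37.toProp36Hypotheses.isCountable (𝒢.galoisLevelData_hconn h37.toProp36Hypotheses) i.1).ker).abuts (β' i) = some (w i)) →
      (∀ ⦃i i' : {i : ℕ // j₀ ≤ i}⦄ (h : i.1 ≤ i'.1),
        (((𝒢.galoisLevelData h37.toProp36Hypotheses).piPresentation h37.toProp36Hypotheses.isCountable T R).cosetGraphTrans ((𝒢.galoisLevelData h37.toProp36Hypotheses).ker_piLevelAut_anti h37.toProp36Hypotheses.isCountable (𝒢.galoisLevelData_hconn h37.toProp36Hypotheses) h)).vertexMap (w i') = w i ∧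
        (((𝒢.galoisLevelData h37.toProp36Hypotheses).piPresentation h37.toProp36Hypotheses.isCountable T R).cosetGraphTrans ((𝒢.galoisLevelData h37.toProp36Hypotheses).ker_piLevelAut_anti h37.toProp36Hypotheses.isCountable (𝒢.galoisLevelData_hconn h37.toProp36Hypotheses) h)).branchMap (β i') = β i ∧
          (((𝒢.galoisLevelData h37.toProp36Hypotheses).piPresentation h37.toProp36Hypotheses.isCountable T R).cosetGraphTrans ((𝒢.galoisLevelData h37.toProp36Hypotheses).ker_piLevelAut_anti h37.toProp36Hypotheses.isCountable (𝒢.galoisLevelData_hconn h37.toProp36Hypotheses) h)).branchMap (β' i') = β' i) →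
      (∀ (i : {i : ℕ // j₀ ≤ i}) (g : outerSemidirectProduct ρ'), g ∈ C →
        (((𝒢.galoisLevelData h37.toProp36Hypotheses).piPresentation h37.toProp36Hypotheses.isCountable T R).arithAct hP ((𝒢.galoisLevelData h37.toProp36Hypotheses).piLevelAut h37.toProp36Hypotheses.isCountable (𝒢.galoisLevelData_hconn h37.toProp36Hypotheses) i.1).ker (hLst i.1) g).hom.vertexMap (w i) = w i ∧
        (((𝒢.galoisLevelData h37.toProp36Hypotheses).piPresentation h37.toProp36Hypotheses.isCountable T R).arithAct hP ((𝒢.galoisLevelData h37.toProp36Hypotheses).piLevelAut h37.toProp36Hypotheses.isCountable (𝒢.galoisLevelData_hconn h37.toProp36Hypotheses) i.1).ker (hLst i.1) g).hom.branchMap (β i) = β i ∧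
          (((𝒢.galoisLevelData h37.toProp36Hypotheses).piPresentation h37.toProp36Hypotheses.isCountable T R).arithAct hP ((𝒢.galoisLevelData h37.toProp36Hypotheses).piLevelAut h37.toProp36Hypotheses.isCountable (𝒢.galoisLevelData_hconn h37.toProp36Hypotheses) i.1).ker (hLst i.1) g).hom.branchMap (β' i) = β' i) →
      ∃ (v : 𝒢.graph.Vertex) (b b' : 𝒢.graph.Branch) (a : PA) (h : outerSemidirectProduct ρ'),
        (decompositionDataOfChart Rc (toOuterSemidirectProduct ρ')).abut b = some v ∧ (decompositionDataOfChart Rc (toOuterSemidirectProduct ρ')).abut b' = some v ∧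
        h ∈ (decompositionDataOfChart Rc (toOuterSemidirectProduct ρ')).vertGp v ∧ (b' ≠ b ∨ h ∉ (decompositionDataOfChart Rc (toOuterSemidirectProduct ρ')).brGp b) ∧
        C.map (outerSemidirectProductSnd ρ') ≤ conjSubgroup a (((decompositionDataOfChart Rc (toOuterSemidirectProduct ρ')).brGp b ⊓
          conjSubgroup h ((decompositionDataOfChart Rc (toOuterSemidirectProduct ρ')).brGp b')).map (outerSemidirectProductSnd ρ')))
    (hest : IsTotallyArithEstranged (decompositionDataOfChart Rc (toOuterSemidirectProduct ρ')) (outerSemidirectProductSnd ρ')) (hbot : ¬ IsArithAmple (outerSemidirectProductSnd ρ') ⊥) :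
    ArithMaximalCompactStatementI (decompositionDataOfChart Rc (toOuterSemidirectProduct ρ')) (outerSemidirectProductSnd ρ') ∧
      ArithMaximalCompactStatementII (decompositionDataOfChart Rc (toOuterSemidirectProduct ρ')) (outerSemidirectProductSnd ρ') :=
  arithMaximalCompactStatement_outerAction_piPresentation_levelTopology h37 hG IsTempered.of_profinite ρ' baseAct T R
    Rc hV hE hopen hBR hP w₀ hLst hK1' hinst noSwitchBase stabBranchPairAug hest hbot

end ProfiniteSemiGraph

end Literature.AnabelianGeometry.SemiGraphs
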